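import Summits.ABC.ABC.Theorems.IsogenyGlueCongruencePolyDegreeOfBoundedPrimesPolyDegreeOfDepthOfCount

/-!
# Stub GLUE-A `stub_primePowersExist_of_degreePrimes_of_excessDepth`, line `Sketch`, crux stmt-ABC-2046

What is proved. The bookkeeping step `A → DEPTH_A∣ → DEPTH∃` of skeleton v3 of crux B
(`PolyDegreeOfBoundedPrimes`, route IsogenyGlueCongruence), where
A = `DegreePrimesPolyBounded` (the crux's hypothesis: some datum `D_A` of every semistable globally
minimal `W`, level `N = W.conductorNorm ℤ`, has all prime factors `ℓ ∣ deg D_A` of size `≤ C_A N^{κ_A}`),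
DEPTH_A∣ = "below every datum `D₀` a datum `D`, `deg D ∣ deg D₀`, whose EXCESS prime powers satisfy
`ℓ^{v_ℓ(deg D) − 1} ≤ C₁ N^{κ₁}` for every prime factor `ℓ`", and
DEPTH∃ = "some datum `D` has all prime powers `ℓ^{v_ℓ(deg D)} ≤ C N^κ`" (the hypothesis of the landed
GLUE v2 `stub_polyDegree_of_depthExists_of_count`, p87649). This is the step of the line where the
crux's hypothesis A is consumed: A carries the SIZES of the primes, DEPTH_A the excess DEPTH.

Proof. Normalise `B_A = max C_A 1`, `K_A = max κ_A 0`, `B₁ = max C₁ 1`, `K₁ = max κ₁ 0` and take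
`κ = K₁ + K_A`, `C = B₁ B_A`. For `W` take `D_A` from A and `D` below `D_A` from DEPTH_A. A prime `ℓ`
dividing `deg D` divides `deg D_A`, so `ℓ ≤ B_A N^{K_A}` and `ℓ^{v−1} ≤ B₁ N^{K₁}`, whence
`ℓ^v = ℓ^{v−1}·ℓ ≤ B₁B_A · N^{K₁+K_A}`; a prime not dividing `deg D` contributes `ℓ⁰ = 1 ≤ C N^κ`
(`C ≥ 1`, `N ≥ 1`, `κ ≥ 0`). Witness: `D`.

Sources: folklore bookkeeping (Mathlib + the landed helper module
`IsogenyGlueCongruencePolyDegreeOfBoundedPrimesPolyDegreeOfDepthOfCount`, p86173: `mul_rpow_mono`,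
`one_le_factorization`); no literature fact is used. Supports `stmt-ABC-2046` (skeleton v3 of line
`Sketch`, `Cruxes/PolyDegreeOfBoundedPrimes/Lines/Sketch.lean`).
-/

-- single-conjunct summit ABC: the duplicate ABC.ABC is mandated (CONVENTIONS §2)
set_option linter.dupNamespace false

namespace Summit.ABC.ABC.Theorems

/-- **GLUE-A stub of the line `Sketch` (crux stmt-ABC-2046), registered form: `A → DEPTH_A∣ → DEPTH∃`.**
Proof: A gives a datum `D_A`
all of whose prime factors are `≤ C_A N^{κ_A}`; DEPTH_A below `D_A` gives `D` with `deg D ∣ deg D_A`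
(so the same primes) and `ℓ^{v−1} ≤ C₁ N^{κ₁}`; hence `ℓ^v = ℓ^{v−1}·ℓ ≤ (B₁ N^{K₁})(B_A N^{K_A})` with the
normalised constants `B = max C 1`, `K = max κ 0`; primes not dividing `deg D` contribute `ℓ⁰ = 1`. -/
theorem stub_primePowersExist_of_degreePrimes_of_excessDepth : Summit.ABC.ABC.Theses.IsogenyGlueCongruence.DegreePrimesPolyBounded → (∃ κ C : ℝ, ∀ (W : WeierstrassCurve ℚ) [W.IsElliptic] [W.IsGloballyMinimal] [NeZero (W.conductorNorm ℤ)], W.IsSemistable ℤ → ∀ D₀ : Literature.NumberTheory.EllipticCurves.ModularForms.ModularParametrizationData W (W.conductorNorm ℤ), ∃ D : Literature.NumberTheory.EllipticCurves.ModularForms.ModularParametrizationData W (W.conductorNorm ℤ), D.modularDegree ∣ D₀.modularDegree ∧ ∀ ℓ ∈ (D.modularDegree).primeFactors, ((ℓ ^ ((D.modularDegree).factorization ℓ - 1) : ℕ) : ℝ) ≤ C * (W.conductorNorm ℤ : ℝ) ^ κ) → ∃ κ C : ℝ, ∀ (W : WeierstrassCurve ℚ) [W.IsElliptic] [W.IsGloballyMinimal]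 [NeZero (W.conductorNorm ℤ)], W.IsSemistable ℤ → ∃ D : Literature.NumberTheory.EllipticCurves.ModularForms.ModularParametrizationData W (W.conductorNorm ℤ), ∀ ℓ : ℕ, ℓ.Prime → ((ℓ ^ (D.modularDegree).factorization ℓ : ℕ) : ℝ) ≤ C * (W.conductorNorm ℤ : ℝ) ^ κ := by
  intro hA hX
  obtain ⟨κA, CA, hA⟩ := hA
  obtain ⟨κ₁, C₁, hX⟩ := hX
  refine ⟨max κ₁ 0 + max κA 0, max C₁ 1 * max CA 1, ?_⟩
  intro W _ _ _ hW
  obtain ⟨DA, hDA⟩ := hA W hW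
  obtain ⟨D, hdvd, hD⟩ := hX W hW DA
  refine ⟨D, fun ℓ hℓ => ?_⟩
  have hN1 : (1 : ℝ) ≤ (W.conductorNorm ℤ : ℝ) := by
    exact_mod_cast Nat.one_le_iff_ne_zero.mpr (NeZero.ne _)
  have hN0 : (0 : ℝ) < (W.conductorNorm ℤ : ℝ) := lt_of_lt_of_le one_pos hN1
  have hB₁ : (1 : ℝ) ≤ max C₁ 1 := le_max_right _ _
  have hBA : (1 : ℝ) ≤ max CA 1 := le_max_right _ _
  have hpow₁ : (1 : ℝ) ≤ (W.conductorNorm ℤ : ℝ) ^ (max κ₁ 0) := Real.one_le_rpow hN1 (le_max_right _ _)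
  have hpowA : (1 : ℝ) ≤ (W.conductorNorm ℤ : ℝ) ^ (max κA 0) := Real.one_le_rpow hN1 (le_max_right _ _)
  by_cases hmem : ℓ ∈ (D.modularDegree).primeFactors
  · -- `ℓ ∣ deg D ∣ deg D_A`: A bounds `ℓ`, DEPTH_A bounds `ℓ^{v-1}`
    have hv : 1 ≤ (D.modularDegree).factorization ℓ :=
      PolyDegreeOfDepthOfCount.one_le_factorization hmem
    have hℓA : ℓ ∣ DA.modularDegree := (Nat.dvd_of_mem_primeFactors hmem).trans hdvd
    have h1 : (ℓ : ℝ) ≤ max CA 1 * (W.conductorNorm ℤ : ℝ) ^ (max κA 0) :=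
      (hDA ℓ hℓ hℓA).trans (PolyDegreeOfDepthOfCount.mul_rpow_mono hN1
        (le_max_left _ _) (le_max_left _ _) (zero_le_one.trans hBA))
    have h2 : ((ℓ ^ ((D.modularDegree).factorization ℓ - 1) : ℕ) : ℝ) ≤
        max C₁ 1 * (W.conductorNorm ℤ : ℝ) ^ (max κ₁ 0) :=
      (hD ℓ hmem).trans (PolyDegreeOfDepthOfCount.mul_rpow_mono hN1
        (le_max_left _ _) (le_max_left _ _) (zero_le_one.trans hB₁))
    have hsplit : ℓ ^ (D.modularDegree).factorization ℓ =
        ℓ ^ ((D.modularDegree).factorization ℓ - 1) * ℓ := by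
      rw [← pow_succ, Nat.sub_add_cancel hv]
    have h2pos : (0 : ℝ) ≤ max C₁ 1 * (W.conductorNorm ℤ : ℝ) ^ (max κ₁ 0) :=
      mul_nonneg (zero_le_one.trans hB₁) (zero_le_one.trans hpow₁)
    calc ((ℓ ^ (D.modularDegree).factorization ℓ : ℕ) : ℝ)
        = ((ℓ ^ ((D.modularDegree).factorization ℓ - 1) : ℕ) : ℝ) * (ℓ : ℝ) := by
          rw [hsplit]; push_cast; ring
      _ ≤ (max C₁ 1 * (W.conductorNorm ℤ : ℝ) ^ (max κ₁ 0)) *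
            (max CA 1 * (W.conductorNorm ℤ : ℝ) ^ (max κA 0)) :=
          mul_le_mul h2 h1 (Nat.cast_nonneg _) h2pos
      _ = (max C₁ 1 * max CA 1) * (W.conductorNorm ℤ : ℝ) ^ (max κ₁ 0 + max κA 0) := by
          rw [Real.rpow_add hN0]; ring
  · -- `ℓ ∤ deg D`: `v_ℓ = 0`, `ℓ⁰ = 1 ≤ C N^κ`
    have hv : (D.modularDegree).factorization ℓ = 0 := by
      rwa [← Nat.support_factorization, Finsupp.mem_support_iff, not_not] at hmem
    rw [hv, pow_zero, Nat.cast_one, Real.rpow_add hN0]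
    exact one_le_mul_of_one_le_of_one_le (one_le_mul_of_one_le_of_one_le hB₁ hBA)
      (one_le_mul_of_one_le_of_one_le hpow₁ hpowA)

end Summit.ABC.ABC.Theorems
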